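import Summits.AtomisticToContinuum.BoseEinsteinCondensation.Theses.BECPopovBerryRG
import Summits.AtomisticToContinuum.BoseEinsteinCondensation.Theorems.BECPopovBerryRGBlockCoherenceToPeriodicBECGlue
import Literature.MathematicalPhysics.QuantumManyBody.BoseGasThermodynamicLimitRuelle

/-!
# `BlockCoherenceToPeriodicBEC` (stmt-AtomisticToContinuum-14494): block phase coherence gives torus BEC

The support item `BECPopovBerryRG.BlockCoherenceToPeriodicBEC` of route `BECPopovBerryRG` is the glue
`BlockPhaseCoherence → PeriodicBEC(v)` (the conclusion is verbatim the body of stmt-0826, the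
hypothesis of `BoundaryTransferWeak`). The mode-independent core — pairwise block coherence of the
flat modes of a tiling bounds the constant-mode occupation, `|ι| · C ≤ 2 n₀`
(`BlockCoherenceGlue.card_mul_le_two_mul_condensateOccupation`) — is in
`Theorems/BECPopovBerryRGBlockCoherenceToPeriodicBECGlue.lean`; here it is applied to the route's
blocks: for `N = n + 1` large, `L = (N/ρ)^{1/3} ≥ ℓ₁`, `m = ⌈L/ℓ₁⌉₊`, `ℓ = L/m ∈ [ℓ₀, ℓ₁]`
(uses `2ℓ₀ ≤ ℓ₁`), blocks `∏_k [z_k ℓ, (z_k+1) ℓ)`, `z ∈ (Fin m)³` (measurable, pairwise disjoint,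
tiling `[0,L)³`, `ℓ³ m³ = L³`), `C = 2cρℓ³`: `m³ · 2cρℓ³ = 2cρL³ = 2cN`, hence
`ofReal (c N) ≤ ⟨Ψ, n₀ Ψ⟩` with the SAME constant `c` (`blockCoherenceToPeriodicBEC_proof`).

References: S. Fournais, *Length scales for BEC in the dilute Bose gas* (2020), (1.3)–(1.5);
E. H. Lieb, R. Seiringer, J. P. Solovej, J. Yngvason, *The Mathematics of the Bose Gas and its
Condensation* (2005), §1.2 (1.17). The block tiling is adapted from
`Theorems/BECStronglyRayleighLatticeToPeriodicBridgeCellPairSumRule.lean`.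
-/

noncomputable section

open MeasureTheory Filter
open scoped ENNReal NNReal ComplexConjugate

namespace Summit.AtomisticToContinuum.BoseEinsteinCondensation.Theorems

open Literature.MathematicalPhysics.QuantumManyBody.BoseGas

namespace BlockCoherenceGlue

/-! ## The blocks `∏_k [z_k ℓ, (z_k + 1) ℓ)` of the route -/

section Blocks

variable {m : ℕ} {ℓ L : ℝ}

/-- The route's blocks are measurable. [folklore] -/
-- adapted from Theorems/BECStronglyRayleighLatticeToPeriodicBridgeCellPairSumRule.lean
theorem measurableSet_block {B : (Fin 3 → Fin m) → Set Space}
    (hB : ∀ z, B z = {x : Space | ∀ k, x k ∈ Set.Ico (((z k : ℕ) : ℝ) * ℓ)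
      ((((z k : ℕ) : ℝ) + 1) * ℓ)}) (z : Fin 3 → Fin m) :
    MeasurableSet (B z) := by
  have h : B z = ⋂ k : Fin 3, (fun x : Space => x k) ⁻¹'
      Set.Ico (((z k : ℕ) : ℝ) * ℓ) ((((z k : ℕ) : ℝ) + 1) * ℓ) := by
    rw [hB]; ext x; simp
  rw [h]
  exact MeasurableSet.iInter fun k => measurableSet_Ico.preimage (by fun_prop)

/-- Distinct blocks are disjoint (`ℓ > 0`). [folklore] -/
-- adapted from Theorems/BECStronglyRayleighLatticeToPeriodicBridgeCellPairSumRule.lean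
theorem pairwise_disjoint_block (hℓ : 0 < ℓ) {B : (Fin 3 → Fin m) → Set Space}
    (hB : ∀ z, B z = {x : Space | ∀ k, x k ∈ Set.Ico (((z k : ℕ) : ℝ) * ℓ)
      ((((z k : ℕ) : ℝ) + 1) * ℓ)}) :
    Pairwise (Function.onFun Disjoint B) := by
  intro z z' hzz'
  change Disjoint (B z) (B z')
  rw [hB, hB]
  refine Set.disjoint_left.2 fun x hx hx' => hzz' ?_
  funext k
  obtain ⟨h1l, h1u⟩ := hx k
  obtain ⟨h2l, h2u⟩ := hx' k
  have i1 : ((z k : ℕ) : ℝ) < ((z' k : ℕ) : ℝ) + 1 :=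
    lt_of_mul_lt_mul_right (h1l.trans_lt h2u) hℓ.le
  have i2 : ((z' k : ℕ) : ℝ) < ((z k : ℕ) : ℝ) + 1 :=
    lt_of_mul_lt_mul_right (h2l.trans_lt h1u) hℓ.le
  have i1' : (z k : ℕ) < (z' k : ℕ) + 1 := by exact_mod_cast i1
  have i2' : (z' k : ℕ) < (z k : ℕ) + 1 := by exact_mod_cast i2
  exact Fin.ext (by omega)

/-- **Tiling.** For `0 < L` and `0 < m` the `m³` blocks of side `L/m` cover `[0,L)³` exactly
(for `t ∈ [0,L)` the index is `⌊t/(L/m)⌋₊ < m`). [folklore] -/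
-- adapted from Theorems/BECStronglyRayleighLatticeToPeriodicBridgeCellPairSumRule.lean
theorem cell_eq_iUnion_block (hL : 0 < L) (hm : 0 < m) {B : (Fin 3 → Fin m) → Set Space}
    (hB : ∀ z, B z = {x : Space | ∀ k, x k ∈ Set.Ico (((z k : ℕ) : ℝ) * (L / m))
      ((((z k : ℕ) : ℝ) + 1) * (L / m))}) :
    cell L = ⋃ z, B z := by
  have hmR : (0 : ℝ) < m := by exact_mod_cast hm
  have hb : 0 < L / m := div_pos hL hmR
  refine Set.Subset.antisymm (fun x hx => ?_) (Set.iUnion_subset fun z => ?_)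
  · have hj : ∀ k, ⌊x k / (L / m)⌋₊ < m := fun k => by
      rw [Nat.floor_lt (div_nonneg (hx k).1 hb.le), div_lt_iff₀ hb]
      calc x k < L := (hx k).2
        _ = (m : ℝ) * (L / m) := by field_simp
    refine Set.mem_iUnion.2 ⟨fun k => ⟨⌊x k / (L / m)⌋₊, hj k⟩, ?_⟩
    rw [hB]
    refine fun k => ⟨?_, ?_⟩
    · calc (((⌊x k / (L / m)⌋₊ : ℕ) : ℝ)) * (L / m) ≤ x k / (L / m) * (L / m) :=
          mul_le_mul_of_nonneg_right (Nat.floor_le (div_nonneg (hx k).1 hb.le)) hb.le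
        _ = x k := div_mul_cancel₀ _ hb.ne'
    · calc x k = x k / (L / m) * (L / m) := (div_mul_cancel₀ _ hb.ne').symm
        _ < (((⌊x k / (L / m)⌋₊ : ℕ) : ℝ) + 1) * (L / m) :=
          mul_lt_mul_of_pos_right (Nat.lt_floor_add_one _) hb
  · rw [hB]
    intro x hx k
    obtain ⟨h1, h2⟩ := hx k
    refine ⟨le_trans (mul_nonneg (Nat.cast_nonneg _) hb.le) h1, ?_⟩
    have hz : ((z k : ℕ) : ℝ) + 1 ≤ m := by exact_mod_cast (z k).isLt
    calc x k < (((z k : ℕ) : ℝ) + 1) * (L / m) := h2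
      _ ≤ (m : ℝ) * (L / m) := mul_le_mul_of_nonneg_right hz hb.le
      _ = L := by field_simp

/-- `(L/m)³ · m³ = L³`: the blocks have the volume normalisation of
`card_mul_le_two_mul_condensateOccupation`. [folklore] -/
theorem block_side_pow_mul_card (hm : 0 < m) (L : ℝ) :
    (L / m) ^ 3 * Fintype.card (Fin 3 → Fin m) = L ^ 3 := by
  have hmR : (m : ℝ) ≠ 0 := by exact_mod_cast hm.ne'
  rw [Fintype.card_fun, Fintype.card_fin, Fintype.card_fin]
  push_cast
  field_simp

end Blocks

/-! ## Bookkeeping for the route's quantifiers -/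

section Route

/-- **Choice of the block number.** For `0 < ℓ₀`, `2ℓ₀ ≤ ℓ₁ ≤ L`, the integer `m = ⌈L/ℓ₁⌉₊` is
positive and `L/m ∈ [ℓ₀, ℓ₁]`. [folklore] -/
theorem exists_blockNumber {ℓ₀ ℓ₁ L : ℝ} (hℓ₀ : 0 < ℓ₀) (hℓ₀₁ : 2 * ℓ₀ ≤ ℓ₁) (hL : ℓ₁ ≤ L) :
    ∃ m : ℕ, 0 < m ∧ ℓ₀ ≤ L / m ∧ L / m ≤ ℓ₁ := by
  have hℓ₁ : 0 < ℓ₁ := by linarith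
  have hLpos : 0 < L := hℓ₁.trans_le hL
  refine ⟨⌈L / ℓ₁⌉₊, Nat.ceil_pos.2 (div_pos hLpos hℓ₁), ?_, ?_⟩
  · have hmR : (0 : ℝ) < (⌈L / ℓ₁⌉₊ : ℕ) := by exact_mod_cast Nat.ceil_pos.2 (div_pos hLpos hℓ₁)
    rw [le_div_iff₀ hmR]
    have h1 : ((⌈L / ℓ₁⌉₊ : ℕ) : ℝ) < L / ℓ₁ + 1 := Nat.ceil_lt_add_one (by positivity)
    have h2 : ((⌈L / ℓ₁⌉₊ : ℕ) : ℝ) * ℓ₁ < L + ℓ₁ := by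
      have := mul_lt_mul_of_pos_right h1 hℓ₁
      rwa [add_mul, one_mul, div_mul_cancel₀ _ hℓ₁.ne'] at this
    nlinarith
  · have hmR : (0 : ℝ) < (⌈L / ℓ₁⌉₊ : ℕ) := by exact_mod_cast Nat.ceil_pos.2 (div_pos hLpos hℓ₁)
    rw [div_le_iff₀ hmR]
    have h1 : L / ℓ₁ ≤ ((⌈L / ℓ₁⌉₊ : ℕ) : ℝ) := Nat.le_ceil _
    rw [div_le_iff₀ hℓ₁] at h1
    linarith [mul_comm ℓ₁ (((⌈L / ℓ₁⌉₊ : ℕ) : ℝ))]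

end Route

end BlockCoherenceGlue

open BlockCoherenceGlue in
/-- **`BlockCoherenceToPeriodicBEC`** (stmt-AtomisticToContinuum-14494, support item of route
`BECPopovBerryRG`): uniform pairwise coherence `occ(φ_z + φ_z') ≥ occ(φ_z) + occ(φ_z') + 2cρℓ³` of
the flat block modes of every near-minimiser on the torus, on one block scale `ℓ = L/m ∈ [ℓ₀, ℓ₁]`,
implies torus BEC in the constant mode with the same constant: `⟨Ψ, n₀Ψ⟩ ≥ c N` for all large `N`
(bilinearity of the occupation form; `m = ⌈L/ℓ₁⌉₊`). [folklore] -/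
theorem blockCoherenceToPeriodicBEC_proof :
    Summit.AtomisticToContinuum.BoseEinsteinCondensation.Theses.BECPopovBerryRG.BlockCoherenceToPeriodicBEC := by
  intro hBPC v hv
  obtain ⟨ρ₀, hρ₀, hρ⟩ := hBPC v hv
  refine ⟨ρ₀, hρ₀, fun ρ hρpos hρlt => ?_⟩
  obtain ⟨c, ℓ₀, ℓ₁, hc, hℓ₀, hℓ₀₁, hev⟩ := hρ ρ hρpos hρlt
  refine ⟨c, hc, ?_⟩
  have hℓ₁ : 0 < ℓ₁ := by linarith
  filter_upwards [hev, (tendsto_sideLength_atTop hρpos).eventually_ge_atTop ℓ₁,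
    eventually_ge_atTop 1] with N hN hLN hN1
  obtain ⟨δ, hδ, hΨ⟩ := hN
  refine ⟨δ, hδ, fun Ψ hΨE => ?_⟩
  obtain ⟨n, rfl⟩ : ∃ n, N = n + 1 := ⟨N - 1, by omega⟩
  have hLpos : 0 < sideLength ρ (n + 1) := hℓ₁.trans_le hLN
  obtain ⟨m, hm, hlo, hhi⟩ := exists_blockNumber hℓ₀ hℓ₀₁ hLN
  have hmR : (0 : ℝ) < m := by exact_mod_cast hm
  have hℓ : 0 < sideLength ρ (n + 1) / m := div_pos hLpos hmR
  have key := hΨ Ψ hΨE m hm hlo hhi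
  have hcore := card_mul_le_two_mul_condensateOccupation (ι := Fin 3 → Fin m) hLpos hℓ
    (B := fun z => {x : Space | ∀ k, x k ∈ Set.Ico (((z k : ℕ) : ℝ) * (sideLength ρ (n + 1) / m))
      ((((z k : ℕ) : ℝ) + 1) * (sideLength ρ (n + 1) / m))})
    (measurableSet_block fun z => rfl) (pairwise_disjoint_block hℓ fun z => rfl)
    (cell_eq_iUnion_block hLpos hm fun z => rfl) (block_side_pow_mul_card hm _) Ψ
    (C := ENNReal.ofReal (2 * c * ρ * (sideLength ρ (n + 1) / m) ^ 3)) key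
  -- arithmetic: `m³ · 2cρ(L/m)³ = 2cρL³ = 2cN`
  have hρL : ρ * sideLength ρ (n + 1) ^ 3 = (n + 1 : ℕ) := by
    have h := div_sideLength_pow_three hρpos (Nat.succ_pos n)
    rw [div_eq_iff (by positivity)] at h
    linarith
  have hcardR : ((Fintype.card (Fin 3 → Fin m) : ℕ) : ℝ≥0∞) = ENNReal.ofReal ((m : ℝ) ^ 3) := by
    rw [Fintype.card_fun, Fintype.card_fin, Fintype.card_fin, ← ENNReal.ofReal_natCast]
    push_cast
    rfl
  have hlhs : ((Fintype.card (Fin 3 → Fin m) : ℕ) : ℝ≥0∞) *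
      ENNReal.ofReal (2 * c * ρ * (sideLength ρ (n + 1) / m) ^ 3) =
      2 * ENNReal.ofReal (c * ((n + 1 : ℕ) : ℝ)) := by
    rw [hcardR, ← ENNReal.ofReal_mul (by positivity), ← hρL, ← ENNReal.ofReal_ofNat,
      ← ENNReal.ofReal_mul (by norm_num)]
    congr 1
    field_simp
  rw [hlhs] at hcore
  exact (ENNReal.mul_le_mul_iff_right two_ne_zero ENNReal.ofNat_ne_top).1 hcore

end Summit.AtomisticToContinuum.BoseEinsteinCondensation.Theorems

end
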